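import Mathlib.Analysis.SpecialFunctions.Pow.NNReal
import Mathlib.Analysis.MeanInequalities
import Mathlib.Algebra.BigOperators.Intervals
import Mathlib.Algebra.Order.BigOperators.Group.Finset
import Mathlib.Data.Fintype.Powerset
import Mathlib.Data.Nat.Choose.Basic
import Mathlib.Data.Nat.Factorial.Basic
import Literature.Probability.Percolation.NetworkReliabilityCuts
import HarnessLib

/-!
# Karger's cut-counting theorem — proof (`Karger1999_cutCounting_holds`)

Discharges the named fact `Literature.Probability.Percolation.Karger1999_cutCounting`
(`NetworkReliabilityCuts.lean`; Karger 1999, Thm. 2.6 = Karger–Stein 1996, Thm. 8.4): in a multigraph on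
`n` vertices all of whose cuts have value `≥ c > 0`, for every real `α ≥ 1` the number of (anchored)
cuts of value `≤ αc` is `< n^{2α}`.

## The printed proof and how it is followed

Source: D. R. Karger, *A randomized fully polynomial time approximation scheme for the all-terminal
network reliability problem*, SIAM J. Comput. **29** (1999) [Karger1999]; we follow the DETERMINISTIC
proof of the appendix of the arXiv version (cs/9809012, "Counting near-minimum cuts", Fact 7.1 –
Thm. 7.5), which is the averaging form of the Contraction-Algorithm sketch of §2.2.3:

* **Fact 7.1** (cuts of `G/e` = cuts of `G` not crossed by `e`, same value). Contraction is
  formalised WITHOUT changing the vertex type: a contracted multigraph is a labelling `f : V → V`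
  (vertex ↦ name of its super-vertex), its cuts are the *saturated* sets `sat f T = {x | f x ∈ T}`
  for label sets `T` inside the range of `f`, and contracting the bundle between the classes `a`, `b`
  is `merge f a b` (relabel `b` as `a`); `sat_merge_erase` is Fact 7.1 and
  `card_filter_sameSide_le` the induced injection of cut families.
* **Lemma 7.2** (a uniformly random edge crosses a fixed `α`-minimum cut with probability `≤ 2α/n`:
  min cut `c` ⇒ min degree `c` ⇒ `≥ nc/2` edges) and **Lemma 7.3** (`f_α(n) ≤ (1-2α/n)^{-1} f_α(n-1)`:
  "the expected number of `α`-minimum cuts of `G/e` is at least `(1-2α/n)k`, so for some `e` …") are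
  proved together as ONE weighted double count over ordered vertex pairs in different classes
  (`card_mul_le_sum_wt` = `E ≥ nc`, `sum_wt_eq_sum_nc_add` = `E = NC(T) + 2·value(T)`,
  `exists_pair_sameSide` = the averaging conclusion). No probability is needed.
* **Thm. 7.5**: unwinding the recurrence down to `k = ⌈2α⌉` classes, where trivially
  `f_α(k) ≤ 2^{k-1}` (`card_fam_le_two_pow`), gives `card_fam_le_P`:
  `#cuts ≤ P = 2^{k-1} ∏_{r=k+1}^{n} r/(r-2α)`.
* The final estimate `P < n^{2α}`. Karger writes `P = 2^{k-1}·C(n,2α)/C(k,2α)` with GENERALISED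
  binomial coefficients (Knuth, Ex. 1.2.6.45) and quotes `C(n,2α) < n^{2α}/(2α)!`, `2^{2α-1} ≤ (2α)!`.
  DEVIATION (shorter road in Lean, no Gamma function): `β ↦ β·log n + Σ_r log(1-β/r)` is concave, so
  the inequality on `β = 2α ∈ (k-1, k]` follows from its two INTEGER endpoints — `2^{k-1}C(n,k) < n^k`
  and `2^{k-1}C(n,k-1) ≤ k·n^{k-1}`, i.e. `Nat.descFactorial_lt_pow` / `Nat.descFactorial_le_pow` and
  `2^{k-1} ≤ k!` — by the two-point weighted AM–GM inequality
  (`Real.geom_mean_le_arith_mean2_weighted`); this is `P_lt_rpow`.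
* Fewer than `k` vertices: the count is `< 2^{n-1} ≤ n^{n-1} ≤ n^{2α}` directly
  (`card_anchored_succ_le`).

## Contents

* namespace `Karger1999`: `cval`, `sat`, `fam`, `merge`, `wt`, `nc`, `P` (proof-internal vocabulary,
  each with unfolding use only) and the lemmas above;
* `Karger1999_cutCounting_holds : Karger1999_cutCounting`.

Not here: `Karger1999_largeCutFailure` (Thm. 2.9) and `LomonosovPolesskii1972_cycleComparison`
(Lemma 4.7) remain named facts in `NetworkReliabilityCuts.lean`.
-/

noncomputable section

open Finset

namespace Literature.Probability.Percolation

namespace Karger1999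


variable {V : Type*} [Fintype V] [DecidableEq V]

/-- Cut value on a general finite vertex type (same formula as `multigraphCutValue`):
`Σ_{x ∈ S} Σ_{y ∉ S} m s(x,y)`. [cite: Karger1999, §2 (cuts and their value)] -/
def cval (m : Sym2 V → ℕ) (S : Finset V) : ℕ := ∑ x ∈ S, ∑ y ∈ Sᶜ, m s(x, y)

/-- The vertex set carrying a label in `T` under the labelling `f` (a union of classes of the
contracted multigraph `G/∼_f`; Karger 1999, Fact 7.1). [cite: Karger1999, appendix Fact 7.1] -/
def sat (f : V → V) (T : Finset V) : Finset V := univ.filter fun x => f x ∈ T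

/-- The anchored family of small cuts of the contracted multigraph `G/∼_f`: label sets `T` inside the
range of `f` that contain the anchor's label, miss some label, and whose saturated cut has value
`≤ t` (Karger 1999, appendix: the `α`-minimum cuts of `G/e` counted by `f_α`).
[cite: Karger1999, appendix Lemma 7.3] -/
noncomputable def fam (m : Sym2 V → ℕ) (f : V → V) (v : V) (t : ℝ) : Finset (Finset V) :=
  (univ.image f).powerset.filter fun T =>
    f v ∈ T ∧ ((univ.image f) \ T).Nonempty ∧ (cval m (sat f T) : ℝ) ≤ t

/-- Contracting the classes labelled `a` and `b`: relabel `b` as `a` (Karger 1999, `G/e`).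
[cite: Karger1999, appendix Fact 7.1] -/
def merge (f : V → V) (a b : V) : V → V := fun z => if f z = b then a else f z

omit [Fintype V] in
/-- Unfolding lemma for `merge`. [cite: Karger1999, appendix Fact 7.1] -/
theorem merge_apply (f : V → V) (a b z : V) :
    merge f a b z = if f z = b then a else f z := rfl

/-- The range of the merged labelling loses exactly the label `b`. [cite: Karger1999, appendix Fact 7.1] -/
theorem image_merge (f : V → V) {a b : V} (ha : a ∈ univ.image f) (hab : a ≠ b) :
    univ.image (merge f a b) = (univ.image f).erase b := by
  ext d
  simp only [mem_image, mem_univ, true_and, mem_erase, merge_apply]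
  constructor
  · rintro ⟨z, rfl⟩
    by_cases hz : f z = b
    · simp only [hz, if_true]
      obtain ⟨x, -, hx⟩ := mem_image.1 ha
      exact ⟨hab, x, hx⟩
    · simp only [hz, if_false]
      exact ⟨hz, z, rfl⟩
  · rintro ⟨hdb, z, rfl⟩
    exact ⟨z, by simp [hdb]⟩

/-- **Fact 7.1** (Karger 1999, appendix): the cuts of `G/e` are exactly the cuts of `G` not crossed by
`e`, with the same value — here: the saturated set of `T.erase b` after merging `b` into `a` is the
saturated set of `T`, provided `a` and `b` lie on the same side of `T`.
[cite: Karger1999, appendix Fact 7.1] -/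
theorem sat_merge_erase (f : V → V) {a b : V} {T : Finset V} (hT : a ∈ T ↔ b ∈ T)
    (hab : a ≠ b) : sat (merge f a b) (T.erase b) = sat f T := by
  ext z
  simp only [sat, mem_filter, mem_univ, true_and, merge_apply, mem_erase]
  by_cases hz : f z = b
  · simp only [hz, if_true]
    constructor
    · rintro ⟨-, h⟩; exact hT.1 h
    · intro h; exact ⟨hab, hT.2 h⟩
  · simp only [hz, if_false]
    exact ⟨fun h => h.2, fun h => ⟨hz, h⟩⟩

/-- The small cuts of `G/∼_f` not separating the classes `a`, `b` inject (by `T ↦ T.erase b`) into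
the small cuts of the further contraction merging `b` into `a` (Karger 1999, proof of Lemma 7.3:
"every `α`-minimum `G`-cut that `e` does not cross corresponds to a distinct `α`-minimum cut in
`G/e`"). [cite: Karger1999, appendix Lemma 7.3] -/
theorem card_filter_sameSide_le (m : Sym2 V → ℕ) (f : V → V) (v : V) (t : ℝ) {a b : V}
    (ha : a ∈ univ.image f) (hab : a ≠ b) :
    ((fam m f v t).filter fun T => (a ∈ T ↔ b ∈ T)).card ≤ (fam m (merge f a b) v t).card := by
  classical
  refine Finset.card_le_card_of_injOn (fun T => T.erase b) ?_ ?_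
  · intro T hT
    rw [Finset.mem_coe, mem_filter] at hT
    obtain ⟨hTf, hside⟩ := hT
    simp only [fam, mem_filter, mem_powerset] at hTf
    obtain ⟨hTR, hvT, hne, hval⟩ := hTf
    rw [Finset.mem_coe]
    simp only [fam, mem_filter, mem_powerset, image_merge f ha hab]
    refine ⟨erase_subset_erase b hTR, ?_, ?_, ?_⟩
    · rw [merge_apply]
      by_cases hvb : f v = b
      · simp only [hvb, if_true]
        exact mem_erase.2 ⟨hab, hside.2 (hvb ▸ hvT)⟩
      · simp only [hvb, if_false]
        exact mem_erase.2 ⟨hvb, hvT⟩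
    · obtain ⟨d, hd⟩ := hne
      rw [mem_sdiff] at hd
      by_cases hdb : d = b
      · subst hdb
        refine ⟨a, mem_sdiff.2 ⟨mem_erase.2 ⟨hab, ha⟩, ?_⟩⟩
        intro haT
        exact hd.2 (hside.1 (mem_of_mem_erase haT))
      · exact ⟨d, mem_sdiff.2 ⟨mem_erase.2 ⟨hdb, hd.1⟩, fun h => hd.2 (mem_of_mem_erase h)⟩⟩
    · rw [sat_merge_erase f hside hab]
      exact hval
  · intro T₁ hT₁ T₂ hT₂ heq
    rw [Finset.mem_coe, mem_filter] at hT₁ hT₂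
    have h1 := hT₁.2
    have h2 := hT₂.2
    simp only at heq
    ext d
    by_cases hdb : d = b
    · subst hdb
      have hab1 : a ∈ T₁.erase d ↔ a ∈ T₂.erase d := by rw [heq]
      rw [mem_erase, mem_erase] at hab1
      constructor
      · intro hd1
        exact h2.1 ((hab1.1 ⟨hab, h1.2 hd1⟩).2)
      · intro hd2
        exact h1.1 ((hab1.2 ⟨hab, h2.2 hd2⟩).2)
    · have : d ∈ T₁.erase b ↔ d ∈ T₂.erase b := by rw [heq]
      simpa [mem_erase, hdb] using this

/-- The anchored small-cut family has at most `2^{n-1}` members, `n` = number of classes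
(Karger 1999, proof of Thm. 7.5: "`f_α(r) ≤ 2^{r-1}` since an `r`-vertex graph has at most this many
cuts"). [cite: Karger1999, appendix Thm. 7.5 (proof)] -/
theorem card_fam_le_two_pow (m : Sym2 V → ℕ) (f : V → V) (v : V) (t : ℝ) :
    (fam m f v t).card ≤ 2 ^ ((univ.image f).card - 1) := by
  classical
  have hv : f v ∈ univ.image f := mem_image_of_mem f (mem_univ v)
  rw [← card_erase_of_mem hv, ← card_powerset]
  refine Finset.card_le_card_of_injOn (fun T => T.erase (f v)) ?_ ?_
  · intro T hT
    rw [Finset.mem_coe] at hT ⊢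
    simp only [fam, mem_filter, mem_powerset] at hT
    exact mem_powerset.2 (erase_subset_erase _ hT.1)
  · intro T₁ hT₁ T₂ hT₂ heq
    rw [Finset.mem_coe] at hT₁ hT₂
    simp only [fam, mem_filter] at hT₁ hT₂
    simp only at heq
    rw [← insert_erase hT₁.2.1, ← insert_erase hT₂.2.1, heq]

/-! ### Lemma 7.2 / 7.3: averaging over the edges between different classes -/

/-- Ordered-pair edge mass between DIFFERENT classes of the labelling `f` (the edges of the
contracted multigraph `G/∼_f`, each unordered bundle counted twice). [cite: Karger1999, appendix Lemma 7.2] -/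
noncomputable def wt (m : Sym2 V → ℕ) (f : V → V) (p : V × V) : ℝ :=
  if f p.1 = f p.2 then 0 else (m s(p.1, p.2) : ℝ)

omit [Fintype V] in
/-- The inter-class edge mass is nonnegative. [cite: Karger1999, appendix Lemma 7.2] -/
theorem wt_nonneg (m : Sym2 V → ℕ) (f : V → V) (p : V × V) : 0 ≤ wt m f p := by
  unfold wt; split_ifs <;> positivity

/-- The cut value as a sum over ordered vertex pairs. [cite: Karger1999, §2 (cuts and their value)] -/
theorem cval_cast_eq (m : Sym2 V → ℕ) (S : Finset V) :
    (cval m S : ℝ) = ∑ p : V × V, if p.1 ∈ S ∧ p.2 ∉ S then (m s(p.1, p.2) : ℝ) else 0 := by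
  rw [Fintype.sum_prod_type]
  simp only [cval, Nat.cast_sum]
  have hin : ∀ x : V, (∑ y ∈ Sᶜ, (m s(x, y) : ℝ)) = ∑ y, if y ∉ S then (m s(x, y) : ℝ) else 0 := by
    intro x
    rw [← Finset.sum_filter]
    refine Finset.sum_congr ?_ fun _ _ => rfl
    ext y; simp
  have hout : (∑ x ∈ S, ∑ y ∈ Sᶜ, (m s(x, y) : ℝ))
      = ∑ x, if x ∈ S then ∑ y ∈ Sᶜ, (m s(x, y) : ℝ) else 0 := by
    rw [← Finset.sum_filter]
    refine Finset.sum_congr ?_ fun _ _ => rfl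
    ext x; simp
  rw [hout]
  refine Finset.sum_congr rfl fun x _ => ?_
  by_cases hx : x ∈ S
  · rw [if_pos hx, hin x]
    refine Finset.sum_congr rfl fun y _ => ?_
    simp [hx]
  · rw [if_neg hx]
    symm
    refine Finset.sum_eq_zero fun y _ => ?_
    simp [hx]

/-- The same sum with the roles of the two coordinates exchanged is again the cut value
(symmetry of `s(x,y)`). [cite: Karger1999, §2 (cuts and their value)] -/
theorem sum_swap_eq_cval (m : Sym2 V → ℕ) (S : Finset V) :
    (∑ p : V × V, if p.2 ∈ S ∧ p.1 ∉ S then (m s(p.1, p.2) : ℝ) else 0) = (cval m S : ℝ) := by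
  rw [cval_cast_eq, ← Equiv.sum_comp (Equiv.prodComm V V)]
  refine Finset.sum_congr rfl fun p _ => ?_
  simp [Sym2.eq_swap]

/-- `E = Σ_p wt(p)` is the sum of the values of the class cuts: `E = Σ_{a} value({f = a})`
(Karger 1999, proof of Lemma 7.2: the number of edges is half the sum of the degrees).
[cite: Karger1999, appendix Lemma 7.2] -/
theorem sum_wt_eq (m : Sym2 V → ℕ) (f : V → V) :
    ∑ p : V × V, wt m f p = ∑ a ∈ univ.image f, (cval m (sat f {a}) : ℝ) := by
  rw [Fintype.sum_prod_type]
  symm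
  calc ∑ a ∈ univ.image f, (cval m (sat f {a}) : ℝ)
      = ∑ a ∈ univ.image f, ∑ x ∈ univ with f x = a,
          ∑ y, (if f y = f x then 0 else (m s(x, y) : ℝ)) := by
        refine Finset.sum_congr rfl fun a _ => ?_
        rw [cval_cast_eq, Fintype.sum_prod_type, Finset.sum_filter]
        refine Finset.sum_congr rfl fun x _ => ?_
        by_cases hx : f x = a
        · rw [if_pos hx]
          refine Finset.sum_congr rfl fun y _ => ?_
          by_cases hy : f y = a
          · simp [sat, hx, hy]
          · simp [sat, hx, hy]
        · rw [if_neg hx]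
          refine Finset.sum_eq_zero fun y _ => ?_
          simp [sat, hx]
    _ = ∑ x, ∑ y, (if f y = f x then 0 else (m s(x, y) : ℝ)) :=
        Finset.sum_fiberwise_of_maps_to (fun x _ => mem_image_of_mem f (mem_univ x)) _
    _ = ∑ x, ∑ y, wt m f (x, y) := by
        refine Finset.sum_congr rfl fun x _ => Finset.sum_congr rfl fun y _ => ?_
        by_cases h : f x = f y
        · simp [wt, h]
        · have h' : ¬ f y = f x := fun h'' => h h''.symm
          simp [wt, h, h']

/-- **Lemma 7.2, first half** (Karger 1999): the contracted multigraph with `n ≥ 2` classes and all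
cuts `≥ c` has at least `n c / 2` edges between classes — here `n·c ≤ E` with every bundle counted
twice. [cite: Karger1999, appendix Lemma 7.2] -/
theorem card_mul_le_sum_wt (m : Sym2 V → ℕ) (f : V → V) {c : ℝ}
    (hcut : ∀ S : Finset V, S.Nonempty → Sᶜ.Nonempty → c ≤ (cval m S : ℝ))
    (hn : 2 ≤ (univ.image f).card) :
    ((univ.image f).card : ℝ) * c ≤ ∑ p : V × V, wt m f p := by
  rw [sum_wt_eq]
  have hall : ∀ a ∈ univ.image f, c ≤ (cval m (sat f {a}) : ℝ) := by
    intro a ha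
    apply hcut
    · obtain ⟨x, -, hx⟩ := mem_image.1 ha
      exact ⟨x, by simp [sat, hx]⟩
    · obtain ⟨a₁, ha₁, a₂, ha₂, hne⟩ := Finset.one_lt_card.1 hn
      by_cases h : a₁ = a
      · obtain ⟨x, -, hx⟩ := mem_image.1 ha₂
        refine ⟨x, ?_⟩
        have : f x ≠ a := by rw [hx, ← h]; exact fun e => hne e.symm
        simp [sat, this]
      · obtain ⟨x, -, hx⟩ := mem_image.1 ha₁
        refine ⟨x, ?_⟩
        have : f x ≠ a := by rw [hx]; exact h
        simp [sat, this]
  calc ((univ.image f).card : ℝ) * c = ∑ a ∈ univ.image f, c := by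
        simp [Finset.sum_const, nsmul_eq_mul]
    _ ≤ ∑ a ∈ univ.image f, (cval m (sat f {a}) : ℝ) := Finset.sum_le_sum hall

/-- The edge mass NOT crossing the saturated cut `T` (ordered pairs in different classes on the same
side). [cite: Karger1999, appendix Lemma 7.3] -/
noncomputable def nc (m : Sym2 V → ℕ) (f : V → V) (T : Finset V) (p : V × V) : ℝ :=
  if f p.1 ≠ f p.2 ∧ (f p.1 ∈ T ↔ f p.2 ∈ T) then (m s(p.1, p.2) : ℝ) else 0

/-- Pointwise split of the inter-class mass into non-crossing mass and the two orientations of the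
crossing mass. [cite: Karger1999, appendix Lemma 7.3] -/
theorem wt_eq_nc_add (m : Sym2 V → ℕ) (f : V → V) (T : Finset V) (p : V × V) :
    wt m f p = nc m f T p
      + (if p.1 ∈ sat f T ∧ p.2 ∉ sat f T then (m s(p.1, p.2) : ℝ) else 0)
      + (if p.2 ∈ sat f T ∧ p.1 ∉ sat f T then (m s(p.1, p.2) : ℝ) else 0) := by
  obtain ⟨x, y⟩ := p
  simp only [wt, nc, sat, mem_filter, mem_univ, true_and]
  by_cases hxy : f x = f y
  · have hiff : (f x ∈ T ↔ f y ∈ T) := by rw [hxy]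
    by_cases hx : f x ∈ T
    · have hy : f y ∈ T := hiff.1 hx
      simp [hxy, hy]
    · have hy : f y ∉ T := fun h => hx (hiff.2 h)
      simp [hxy, hy]
  · by_cases hx : f x ∈ T
    · by_cases hy : f y ∈ T
      · simp [hxy, hx, hy]
      · simp [hxy, hx, hy]
    · by_cases hy : f y ∈ T
      · simp [hxy, hx, hy]
      · simp [hxy, hx, hy]

/-- `E = NC(T) + 2·value(S_T)` (Karger 1999, proof of Lemma 7.3). [cite: Karger1999, appendix Lemma 7.3] -/
theorem sum_wt_eq_sum_nc_add (m : Sym2 V → ℕ) (f : V → V) (T : Finset V) :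
    ∑ p : V × V, wt m f p = (∑ p : V × V, nc m f T p) + 2 * (cval m (sat f T) : ℝ) := by
  rw [Finset.sum_congr rfl fun p _ => wt_eq_nc_add m f T p, Finset.sum_add_distrib,
    Finset.sum_add_distrib, sum_swap_eq_cval, ← cval_cast_eq]
  ring

/-- Summing the non-crossing mass over the family counts, for each ordered pair, the members of the
family not separating it. [cite: Karger1999, appendix Lemma 7.3] -/
theorem sum_nc_eq (m : Sym2 V → ℕ) (f : V → V) (v : V) (t : ℝ) (p : V × V) :
    ∑ T ∈ fam m f v t, nc m f T p
      = wt m f p * (((fam m f v t).filter fun T => (f p.1 ∈ T ↔ f p.2 ∈ T)).card : ℝ) := by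
  by_cases h : f p.1 = f p.2
  · have : ∀ T, nc m f T p = 0 := fun T => by simp [nc, h]
    simp [this, wt, h]
  · have hwt : wt m f p = (m s(p.1, p.2) : ℝ) := by simp [wt, h]
    rw [hwt]
    have : ∀ T, nc m f T p = if (f p.1 ∈ T ↔ f p.2 ∈ T) then (m s(p.1, p.2) : ℝ) else 0 := by
      intro T; simp [nc, h]
    simp_rw [this]
    rw [← Finset.sum_filter, Finset.sum_const, nsmul_eq_mul, mul_comm]

/-- **Lemma 7.2 + Lemma 7.3** (Karger 1999, averaging form): in a contracted multigraph with `n ≥ 2`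
classes, all cuts `≥ c > 0`, and a family of `K` anchored cuts of value `≤ t`, `2t ≤ βc`, some pair
of distinct classes is separated by at most a `β/n` fraction of the family: at least `K(1 - β/n)`
members keep the two classes on the same side ("for some `e`, `G/e` has at least `(1 - 2α/n)k`
`α`-minimum cuts"). [cite: Karger1999, appendix Lemma 7.3] -/
theorem exists_pair_sameSide (m : Sym2 V → ℕ) (f : V → V) (v : V) {c β t : ℝ} (hc : 0 < c)
    (hcut : ∀ S : Finset V, S.Nonempty → Sᶜ.Nonempty → c ≤ (cval m S : ℝ))
    (hβ : 0 ≤ β) (ht : 2 * t ≤ β * c) (hn : 2 ≤ (univ.image f).card) :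
    ∃ x y : V, f x ≠ f y ∧
      ((fam m f v t).card : ℝ) * (1 - β / (univ.image f).card) ≤
        (((fam m f v t).filter fun T => (f x ∈ T ↔ f y ∈ T)).card : ℝ) := by
  set E : ℝ := ∑ p : V × V, wt m f p with hEdef
  have hE : ((univ.image f).card : ℝ) * c ≤ E := card_mul_le_sum_wt m f hcut hn
  have hn0 : (0 : ℝ) < (univ.image f).card := by
    have : (2 : ℝ) ≤ (univ.image f).card := by exact_mod_cast hn
    linarith
  have hEpos : 0 < E := lt_of_lt_of_le (mul_pos hn0 hc) hE
  -- non-crossing mass of each member is at least E (1 - β/n)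
  have hNC : ∀ T ∈ fam m f v t,
      E * (1 - β / (univ.image f).card) ≤ ∑ p : V × V, nc m f T p := by
    intro T hT
    have hval : (cval m (sat f T) : ℝ) ≤ t := by
      simp only [fam, mem_filter] at hT
      exact hT.2.2.2
    have hdec := sum_wt_eq_sum_nc_add m f T
    have hcE : c ≤ E / (univ.image f).card := by
      rw [le_div_iff₀ hn0]; linarith
    have h1 : β * c ≤ β * (E / (univ.image f).card) := mul_le_mul_of_nonneg_left hcE hβ
    calc E * (1 - β / (univ.image f).card) = E - β * (E / (univ.image f).card) := by ring
      _ ≤ E - 2 * (cval m (sat f T) : ℝ) := by linarith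
      _ = ∑ p : V × V, nc m f T p := by linarith
  -- sum over the family and exchange the sums
  have hsum : ((fam m f v t).card : ℝ) * (E * (1 - β / (univ.image f).card)) ≤
      ∑ p : V × V, wt m f p *
        (((fam m f v t).filter fun T => (f p.1 ∈ T ↔ f p.2 ∈ T)).card : ℝ) := by
    calc ((fam m f v t).card : ℝ) * (E * (1 - β / (univ.image f).card))
        = ∑ T ∈ fam m f v t, E * (1 - β / (univ.image f).card) := by
          simp [Finset.sum_const, nsmul_eq_mul]
      _ ≤ ∑ T ∈ fam m f v t, ∑ p : V × V, nc m f T p := Finset.sum_le_sum hNC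
      _ = ∑ p : V × V, ∑ T ∈ fam m f v t, nc m f T p := Finset.sum_comm
      _ = _ := Finset.sum_congr rfl fun p _ => sum_nc_eq m f v t p
  -- averaging
  by_contra hcon
  push Not at hcon
  have hle : ∀ p ∈ (univ : Finset (V × V)), wt m f p *
      (((fam m f v t).filter fun T => (f p.1 ∈ T ↔ f p.2 ∈ T)).card : ℝ) ≤
        wt m f p * (((fam m f v t).card : ℝ) * (1 - β / (univ.image f).card)) := by
    intro p _
    by_cases h : f p.1 = f p.2
    · simp [wt, h]
    · exact mul_le_mul_of_nonneg_left (hcon p.1 p.2 h).le (wt_nonneg m f p)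
  obtain ⟨p, -, hp⟩ : ∃ p ∈ (univ : Finset (V × V)), (0 : ℝ) < wt m f p := by
    apply Finset.exists_lt_of_sum_lt
    simpa using hEpos
  have hp' : f p.1 ≠ f p.2 := by
    intro h; simp [wt, h] at hp
  have hlt : ∃ p ∈ (univ : Finset (V × V)), wt m f p *
      (((fam m f v t).filter fun T => (f p.1 ∈ T ↔ f p.2 ∈ T)).card : ℝ) <
        wt m f p * (((fam m f v t).card : ℝ) * (1 - β / (univ.image f).card)) :=
    ⟨p, mem_univ _, mul_lt_mul_of_pos_left (hcon p.1 p.2 hp') hp⟩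
  have hstrict := Finset.sum_lt_sum hle hlt
  rw [← Finset.sum_mul] at hstrict
  linarith

/-! ### Theorem 7.5: unwinding the recurrence -/

/-- Karger's unwound recurrence bound: `P β k n = 2^{k-1} ∏_{r=k+1}^{n} r/(r-β)`
(Karger 1999, proof of Thm. 7.5: `f_α(n) ≤ ∏ (1 - 2α/r)^{-1} · f_α(r)`, `f_α(r) ≤ 2^{r-1}`).
[cite: Karger1999, Thm. 2.6 (proof, appendix Thm. 7.5)] -/
noncomputable def P (β : ℝ) (k n : ℕ) : ℝ :=
  2 ^ (k - 1) * ∏ r ∈ Ioc k n, ((r : ℝ) / ((r : ℝ) - β))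

/-- **Lemma 7.3 unwound** (Karger 1999, proof of Thm. 7.5): for a labelling with `n` classes the
anchored family of cuts of value `≤ t` (`2t ≤ βc`, all cuts `≥ c > 0`, `0 ≤ β ≤ k`, `k ≥ 1`) has at
most `P β k n = 2^{k-1} ∏_{r=k+1}^{n} r/(r-β)` members; by induction on `n`, contracting the pair of
classes provided by `exists_pair_sameSide`. [cite: Karger1999, appendix Lemma 7.3, Thm. 7.5] -/
theorem card_fam_le_P (m : Sym2 V → ℕ) (v : V) {c β t : ℝ} {k : ℕ} (hc : 0 < c)
    (hcut : ∀ S : Finset V, S.Nonempty → Sᶜ.Nonempty → c ≤ (cval m S : ℝ))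
    (hβ : 0 ≤ β) (ht : 2 * t ≤ β * c) (hβk : β ≤ k) (hk : 1 ≤ k) :
    ∀ (n : ℕ) (f : V → V), (univ.image f).card = n → ((fam m f v t).card : ℝ) ≤ P β k n := by
  intro n
  induction n using Nat.strong_induction_on with
  | _ n ih =>
  intro f hfn
  by_cases hnk : n ≤ k
  · have h1 := card_fam_le_two_pow m f v t
    rw [hfn] at h1
    have h2 : (2 : ℝ) ^ (n - 1) ≤ 2 ^ (k - 1) := pow_le_pow_right₀ (by norm_num) (by omega)
    have hP : P β k n = 2 ^ (k - 1) := by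
      simp [P, Finset.Ioc_eq_empty (show ¬ k < n by omega)]
    calc ((fam m f v t).card : ℝ) ≤ 2 ^ (n - 1) := by exact_mod_cast h1
      _ ≤ 2 ^ (k - 1) := h2
      _ = P β k n := hP.symm
  · push Not at hnk
    obtain ⟨n', rfl⟩ : ∃ n', n = n' + 1 := ⟨n - 1, by omega⟩
    have hn2 : 2 ≤ (univ.image f).card := by rw [hfn]; omega
    obtain ⟨x, y, hxy, hK⟩ := exists_pair_sameSide m f v hc hcut hβ ht hn2
    have ha : f x ∈ univ.image f := mem_image_of_mem f (mem_univ x)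
    have hinj := card_filter_sameSide_le m f v t ha hxy
    have hcard' : (univ.image (merge f (f x) (f y))).card = n' := by
      rw [image_merge f ha hxy, card_erase_of_mem (mem_image_of_mem f (mem_univ y)), hfn]
      simp
    have hIH := ih n' (by omega) (merge f (f x) (f y)) hcard'
    rw [hfn] at hK
    have hβn : β < ((n' + 1 : ℕ) : ℝ) := lt_of_le_of_lt hβk (by exact_mod_cast hnk)
    have hpos : (0 : ℝ) < ((n' + 1 : ℕ) : ℝ) - β := by linarith
    have hn0 : (0 : ℝ) < ((n' + 1 : ℕ) : ℝ) := by positivity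
    have hchain : ((fam m f v t).card : ℝ) * (1 - β / ((n' + 1 : ℕ) : ℝ)) ≤ P β k n' :=
      hK.trans (le_trans (by exact_mod_cast hinj) hIH)
    have hP : P β k (n' + 1) = P β k n' * (((n' + 1 : ℕ) : ℝ) / (((n' + 1 : ℕ) : ℝ) - β)) := by
      simp only [P]
      rw [Finset.prod_Ioc_succ_top (by omega : k ≤ n'), mul_assoc]
    rw [hP]
    have h1 : 1 - β / ((n' + 1 : ℕ) : ℝ) = (((n' + 1 : ℕ) : ℝ) - β) / ((n' + 1 : ℕ) : ℝ) := by
      field_simp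
    rw [h1] at hchain
    have h2 := (le_div_iff₀ (div_pos hpos hn0)).2 hchain
    calc ((fam m f v t).card : ℝ)
        ≤ P β k n' / ((((n' + 1 : ℕ) : ℝ) - β) / ((n' + 1 : ℕ) : ℝ)) := h2
      _ = P β k n' * (((n' + 1 : ℕ) : ℝ) / (((n' + 1 : ℕ) : ℝ) - β)) := by
          rw [div_div_eq_mul_div, mul_div_assoc]

/-! ### Few vertices: the trivial count -/

/-- Anchored vertex sets with nonempty complement (and any further property) are fewer than
`2^{|V|-1}`: together with `univ` they inject into the subsets of `V ∖ {v}`.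
(Karger 1999, proof of Thm. 7.5: an `r`-vertex graph has at most `2^{r-1}` cuts.)
[cite: Karger1999, appendix Thm. 7.5 (proof)] -/
theorem card_anchored_succ_le (v : V) (p : Finset V → Prop) [DecidablePred p] :
    (univ.filter fun S : Finset V => v ∈ S ∧ Sᶜ.Nonempty ∧ p S).card + 1
      ≤ 2 ^ (Fintype.card V - 1) := by
  classical
  set F := univ.filter fun S : Finset V => v ∈ S ∧ Sᶜ.Nonempty ∧ p S with hF
  have huniv : (univ : Finset V) ∉ F := by simp [hF]
  rw [← Finset.card_insert_of_notMem huniv]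
  have hle : (insert (univ : Finset V) F).card ≤ ((univ.erase v).powerset).card := by
    refine Finset.card_le_card_of_injOn (fun S => S.erase v) ?_ ?_
    · intro S hS
      rw [Finset.mem_coe] at hS ⊢
      exact mem_powerset.2 (erase_subset_erase v (subset_univ S))
    · have hmem : ∀ S ∈ insert (univ : Finset V) F, v ∈ S := by
        intro S hS
        rcases mem_insert.1 hS with rfl | hS
        · exact mem_univ v
        · exact (mem_filter.1 hS).2.1
      intro S₁ h₁ S₂ h₂ heq
      rw [Finset.mem_coe] at h₁ h₂
      simp only at heq
      rw [← insert_erase (hmem S₁ h₁), ← insert_erase (hmem S₂ h₂), heq]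
  rwa [card_powerset, card_erase_of_mem (mem_univ v), Finset.card_univ] at hle




/-- `2^{k-1} ≤ k!` for `k ≥ 1` (Karger: "`2^{2α-1} ≤ (2α)!`"), from Mathlib's
`Nat.pow_succ_le_ascFactorial` (`2^j ≤ 2·3⋯(j+1)`) and `Nat.factorial_mul_ascFactorial`.
[cite: Karger1999, Thm. 2.6 (proof)] -/
theorem two_pow_pred_le_factorial {k : ℕ} (hk : 1 ≤ k) : 2 ^ (k - 1) ≤ k.factorial := by
  obtain ⟨j, rfl⟩ : ∃ j, k = j + 1 := ⟨k - 1, by omega⟩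
  have h1 : 2 ^ j ≤ (2 : ℕ).ascFactorial j := Nat.pow_succ_le_ascFactorial 2 j
  have h2 : (1 : ℕ).factorial * (1 + 1).ascFactorial j = (1 + j).factorial :=
    Nat.factorial_mul_ascFactorial 1 j
  rw [Nat.factorial_one, one_mul, Nat.add_comm 1 j] at h2
  rw [Nat.add_sub_cancel, ← h2]
  exact h1

/-- Closed form of the integer-endpoint product: `(∏_{r=k+1}^{n} (r-k)/r) · C(n,k) = 1`. [folklore] -/
theorem prod_Ioc_sub_div_mul_choose (k : ℕ) :
    ∀ n, k ≤ n → (∏ r ∈ Ioc k n, (((r : ℝ) - k) / r)) * (n.choose k : ℝ) = 1 := by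
  intro n hn
  induction n, hn using Nat.le_induction with
  | base => simp
  | succ n hn ih =>
    rw [Finset.prod_Ioc_succ_top hn, mul_assoc]
    have h1 : ((n + 1 : ℕ) : ℝ) ≠ 0 := by positivity
    have h2 : ((n + 1 : ℕ) : ℝ) - k ≠ 0 := by
      rw [Nat.cast_add, Nat.cast_one]
      have : (k : ℝ) ≤ n := by exact_mod_cast hn
      linarith
    have hch : (((n + 1).choose k : ℕ) : ℝ) * (((n + 1 : ℕ) : ℝ) - k)
        = (n.choose k : ℝ) * ((n + 1 : ℕ) : ℝ) := by
      have := Nat.choose_mul_succ_eq n k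
      have hk' : k ≤ n + 1 := by omega
      have hc : (((n + 1 - k : ℕ) : ℝ)) = ((n + 1 : ℕ) : ℝ) - k := by
        rw [Nat.cast_sub hk']
      rw [← hc]
      exact_mod_cast this.symm
    calc (∏ r ∈ Ioc k n, (((r : ℝ) - k) / r)) *
          ((((n + 1 : ℕ) : ℝ) - k) / ((n + 1 : ℕ) : ℝ) * (((n + 1).choose k : ℕ) : ℝ))
        = (∏ r ∈ Ioc k n, (((r : ℝ) - k) / r)) *
          ((((n + 1).choose k : ℕ) : ℝ) * (((n + 1 : ℕ) : ℝ) - k) / ((n + 1 : ℕ) : ℝ)) := by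
          ring
      _ = (∏ r ∈ Ioc k n, (((r : ℝ) - k) / r)) * (n.choose k : ℝ) := by
          rw [hch, mul_div_assoc, div_self h1, mul_one]
      _ = 1 := ih

/-- Closed form of the other integer-endpoint product:
`(∏_{r=k+1}^{n} (r-k+1)/r) · C(n,k-1) = k` for `k ≥ 1`. [folklore] -/
theorem prod_Ioc_sub_add_one_div_mul_choose {k : ℕ} (hk : 1 ≤ k) :
    ∀ n, k ≤ n → (∏ r ∈ Ioc k n, (((r : ℝ) - k + 1) / r)) * (n.choose (k - 1) : ℝ) = k := by
  intro n hn
  induction n, hn using Nat.le_induction with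
  | base =>
    obtain ⟨j, rfl⟩ : ∃ j, k = j + 1 := ⟨k - 1, by omega⟩
    simp [Nat.choose_succ_self_right]
  | succ n hn ih =>
    rw [Finset.prod_Ioc_succ_top hn, mul_assoc]
    have h1 : ((n + 1 : ℕ) : ℝ) ≠ 0 := by positivity
    have hkr : (k : ℝ) ≤ n := by exact_mod_cast hn
    have h2 : ((n + 1 : ℕ) : ℝ) - k + 1 ≠ 0 := by
      rw [Nat.cast_add, Nat.cast_one]; linarith
    have hch : (((n + 1).choose (k - 1) : ℕ) : ℝ) * (((n + 1 : ℕ) : ℝ) - k + 1)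
        = (n.choose (k - 1) : ℝ) * ((n + 1 : ℕ) : ℝ) := by
      have := Nat.choose_mul_succ_eq n (k - 1)
      have hk' : k - 1 ≤ n + 1 := by omega
      have hc : (((n + 1 - (k - 1) : ℕ) : ℝ)) = ((n + 1 : ℕ) : ℝ) - k + 1 := by
        rw [Nat.cast_sub hk', Nat.cast_sub hk]; push_cast; ring
      rw [← hc]
      exact_mod_cast this.symm
    calc (∏ r ∈ Ioc k n, (((r : ℝ) - k + 1) / r)) *
          ((((n + 1 : ℕ) : ℝ) - k + 1) / ((n + 1 : ℕ) : ℝ) * (((n + 1).choose (k - 1) : ℕ) : ℝ))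
        = (∏ r ∈ Ioc k n, (((r : ℝ) - k + 1) / r)) *
          ((((n + 1).choose (k - 1) : ℕ) : ℝ) * (((n + 1 : ℕ) : ℝ) - k + 1) / ((n + 1 : ℕ) : ℝ)) := by
          ring
      _ = (∏ r ∈ Ioc k n, (((r : ℝ) - k + 1) / r)) * (n.choose (k - 1) : ℝ) := by
          rw [hch, mul_div_assoc, div_self h1, mul_one]
      _ = k := ih

/-- Endpoint `β = k`: `2^{k-1} < n^k · ∏_{r=k+1}^{n} (r-k)/r = n^k / C(n,k)` for `2 ≤ k ≤ n`
(i.e. `2^{k-1} C(n,k) ≤ k!·C(n,k) = n(n-1)⋯(n-k+1) < n^k`). [folklore] -/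
theorem two_pow_lt_pow_mul_prod {k n : ℕ} (hk : 2 ≤ k) (hkn : k ≤ n) :
    (2 : ℝ) ^ (k - 1) < (n : ℝ) ^ k * ∏ r ∈ Ioc k n, (((r : ℝ) - k) / r) := by
  have hC : (0 : ℝ) < (n.choose k : ℝ) := by exact_mod_cast Nat.choose_pos hkn
  have hprod : (∏ r ∈ Ioc k n, (((r : ℝ) - k) / r)) = 1 / (n.choose k : ℝ) := by
    rw [eq_div_iff hC.ne']
    exact prod_Ioc_sub_div_mul_choose k n hkn
  rw [hprod]
  have hnat : 2 ^ (k - 1) * n.choose k < n ^ k := by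
    calc 2 ^ (k - 1) * n.choose k ≤ k.factorial * n.choose k :=
          Nat.mul_le_mul_right _ (two_pow_pred_le_factorial (by omega))
      _ = n.descFactorial k := (Nat.descFactorial_eq_factorial_mul_choose n k).symm
      _ < n ^ k := Nat.descFactorial_lt_pow (by omega) hk
  have hreal : (2 : ℝ) ^ (k - 1) * (n.choose k : ℝ) < (n : ℝ) ^ k := by exact_mod_cast hnat
  rw [mul_one_div, lt_div_iff₀ hC]
  exact hreal

/-- Endpoint `β = k-1`: `2^{k-1} ≤ n^{k-1} · ∏_{r=k+1}^{n} (r-k+1)/r = k·n^{k-1}/C(n,k-1)` for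
`1 ≤ k ≤ n` (i.e. `2^{k-1} C(n,k-1) ≤ k·(k-1)!·C(n,k-1) = k·n(n-1)⋯(n-k+2) ≤ k·n^{k-1}`). [folklore] -/
theorem two_pow_le_pow_mul_prod {k n : ℕ} (hk : 1 ≤ k) (hkn : k ≤ n) :
    (2 : ℝ) ^ (k - 1) ≤ (n : ℝ) ^ (k - 1) * ∏ r ∈ Ioc k n, (((r : ℝ) - k + 1) / r) := by
  have hC : (0 : ℝ) < (n.choose (k - 1) : ℝ) := by exact_mod_cast Nat.choose_pos (by omega)
  have hprod : (∏ r ∈ Ioc k n, (((r : ℝ) - k + 1) / r)) = k / (n.choose (k - 1) : ℝ) := by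
    rw [eq_div_iff hC.ne']
    exact prod_Ioc_sub_add_one_div_mul_choose hk n hkn
  rw [hprod]
  have hnat : 2 ^ (k - 1) * n.choose (k - 1) ≤ n ^ (k - 1) * k := by
    obtain ⟨j, rfl⟩ : ∃ j, k = j + 1 := ⟨k - 1, by omega⟩
    simp only [Nat.add_sub_cancel]
    calc 2 ^ j * n.choose j ≤ (j + 1).factorial * n.choose j :=
          Nat.mul_le_mul_right _ (by simpa using two_pow_pred_le_factorial (Nat.succ_pos j))
      _ = (j + 1) * (j.factorial * n.choose j) := by rw [Nat.factorial_succ]; ring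
      _ = (j + 1) * n.descFactorial j := by rw [Nat.descFactorial_eq_factorial_mul_choose]
      _ ≤ (j + 1) * n ^ j := Nat.mul_le_mul_left _ (Nat.descFactorial_le_pow n j)
      _ = n ^ j * (j + 1) := by ring
  have hreal : (2 : ℝ) ^ (k - 1) * (n.choose (k - 1) : ℝ) ≤ (n : ℝ) ^ (k - 1) * k := by
    exact_mod_cast hnat
  rw [← mul_div_assoc, le_div_iff₀ hC]
  exact hreal

/-- **The final inequality of Karger's Thm. 7.5 without generalised binomials**: for an integer
`k ≥ 2`, `k ≤ n` and real `β` with `k - 1 < β ≤ k`,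
`2^{k-1} ∏_{r=k+1}^{n} r/(r-β) < n^{β}`.
Karger (1999, proof of Thm. 2.6 / Thm. 7.5) writes the left side as `2^{k-1} C(n,2α)/C(k,2α)` with
generalised binomial coefficients (Knuth, Ex. 1.2.6.45). Here instead: `β ↦ β log n + Σ_r log(1-β/r)`
is concave, so it suffices to interpolate between the two integer endpoints `β = k-1`
(`two_pow_le_pow_mul_prod`) and `β = k` (`two_pow_lt_pow_mul_prod`) with the two-point weighted AM–GM
inequality. [cite: Karger1999, Thm. 2.6 (proof, appendix Thm. 7.5)] -/
theorem P_lt_rpow {k n : ℕ} {β : ℝ} (hk : 2 ≤ k) (hkn : k ≤ n) (hβk : β ≤ k)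
    (hkβ : (k : ℝ) - 1 < β) : P β k n < (n : ℝ) ^ β := by
  set l : ℝ := (k : ℝ) - β with hl
  have hl0 : 0 ≤ l := by rw [hl]; linarith
  have hl1 : l < 1 := by rw [hl]; linarith
  have hn0 : (0 : ℝ) < n := by
    have : (2 : ℝ) ≤ n := by exact_mod_cast hk.trans hkn
    linarith
  have h2pos : (0 : ℝ) < (2 : ℝ) ^ (k - 1) := by positivity
  -- the two endpoint quantities
  set A : ℝ := (n : ℝ) ^ (k - 1) * ∏ r ∈ Ioc k n, (((r : ℝ) - k + 1) / r) with hA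
  set B : ℝ := (n : ℝ) ^ k * ∏ r ∈ Ioc k n, (((r : ℝ) - k) / r) with hB
  have hA2 : (2 : ℝ) ^ (k - 1) ≤ A := two_pow_le_pow_mul_prod (by omega) hkn
  have hB2 : (2 : ℝ) ^ (k - 1) < B := two_pow_lt_pow_mul_prod hk hkn
  have hApos : 0 < A := h2pos.trans_le hA2
  -- nonnegativity of the factors
  have hp1 : ∀ r ∈ Ioc k n, (0 : ℝ) ≤ ((r : ℝ) - k + 1) / r := by
    intro r hr
    have hkr : k < r := (Finset.mem_Ioc.1 hr).1
    have : (k : ℝ) < r := by exact_mod_cast hkr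
    exact div_nonneg (by linarith) (by positivity)
  have hp2 : ∀ r ∈ Ioc k n, (0 : ℝ) ≤ ((r : ℝ) - k) / r := by
    intro r hr
    have hkr : k < r := (Finset.mem_Ioc.1 hr).1
    have : (k : ℝ) < r := by exact_mod_cast hkr
    exact div_nonneg (by linarith) (by positivity)
  -- termwise weighted AM–GM
  have hterm : ∀ r ∈ Ioc k n,
      (((r : ℝ) - k + 1) / r) ^ l * (((r : ℝ) - k) / r) ^ (1 - l) ≤ ((r : ℝ) - β) / r := by
    intro r hr
    have hkr : k < r := (Finset.mem_Ioc.1 hr).1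
    have hkr' : (k : ℝ) < r := by exact_mod_cast hkr
    have hr0 : (r : ℝ) ≠ 0 := by
      have : (0 : ℝ) < r := by exact_mod_cast (by omega : 0 < r)
      exact this.ne'
    have h := Real.geom_mean_le_arith_mean2_weighted hl0 (by linarith : 0 ≤ 1 - l) (hp1 r hr)
      (hp2 r hr) (by ring)
    calc (((r : ℝ) - k + 1) / r) ^ l * (((r : ℝ) - k) / r) ^ (1 - l)
        ≤ l * (((r : ℝ) - k + 1) / r) + (1 - l) * (((r : ℝ) - k) / r) := h
      _ = ((r : ℝ) - β) / r := by rw [hl]; field_simp; ring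
  have hprod : (∏ r ∈ Ioc k n, (((r : ℝ) - k + 1) / r)) ^ l *
      (∏ r ∈ Ioc k n, (((r : ℝ) - k) / r)) ^ (1 - l) ≤ ∏ r ∈ Ioc k n, (((r : ℝ) - β) / r) := by
    rw [← Real.finsetProd_rpow _ _ hp1 l, ← Real.finsetProd_rpow _ _ hp2 (1 - l),
      ← Finset.prod_mul_distrib]
    exact Finset.prod_le_prod (fun r hr => mul_nonneg (Real.rpow_nonneg (hp1 r hr) _)
      (Real.rpow_nonneg (hp2 r hr) _)) hterm
  -- n^β splits accordingly
  have hnβ : (n : ℝ) ^ β = ((n : ℝ) ^ (k - 1)) ^ l * ((n : ℝ) ^ k) ^ (1 - l) := by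
    rw [← Real.rpow_natCast (n : ℝ) (k - 1), ← Real.rpow_natCast (n : ℝ) k,
      ← Real.rpow_mul hn0.le, ← Real.rpow_mul hn0.le, ← Real.rpow_add hn0]
    congr 1
    rw [Nat.cast_sub (by omega : 1 ≤ k), hl]; push_cast; ring
  -- assemble: 2^{k-1} < A^l B^{1-l} ≤ n^β ∏ (r-β)/r
  have h2split : (2 : ℝ) ^ (k - 1) = ((2 : ℝ) ^ (k - 1)) ^ l * ((2 : ℝ) ^ (k - 1)) ^ (1 - l) := by
    rw [← Real.rpow_add h2pos]; norm_num
  have hAl : ((2 : ℝ) ^ (k - 1)) ^ l ≤ A ^ l := Real.rpow_le_rpow h2pos.le hA2 hl0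
  have hBl : ((2 : ℝ) ^ (k - 1)) ^ (1 - l) < B ^ (1 - l) :=
    Real.rpow_lt_rpow h2pos.le hB2 (by linarith)
  have key : (2 : ℝ) ^ (k - 1) < (n : ℝ) ^ β * ∏ r ∈ Ioc k n, (((r : ℝ) - β) / r) := by
    calc (2 : ℝ) ^ (k - 1) = ((2 : ℝ) ^ (k - 1)) ^ l * ((2 : ℝ) ^ (k - 1)) ^ (1 - l) := h2split
      _ < A ^ l * B ^ (1 - l) :=
          mul_lt_mul' hAl hBl (Real.rpow_nonneg h2pos.le _) (Real.rpow_pos_of_pos hApos _)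
      _ = ((n : ℝ) ^ (k - 1)) ^ l * ((n : ℝ) ^ k) ^ (1 - l) *
            ((∏ r ∈ Ioc k n, (((r : ℝ) - k + 1) / r)) ^ l *
              (∏ r ∈ Ioc k n, (((r : ℝ) - k) / r)) ^ (1 - l)) := by
          rw [hA, hB, Real.mul_rpow (by positivity) (Finset.prod_nonneg hp1),
            Real.mul_rpow (by positivity) (Finset.prod_nonneg hp2)]
          ring
      _ ≤ (n : ℝ) ^ β * ∏ r ∈ Ioc k n, (((r : ℝ) - β) / r) := by
          rw [hnβ]
          exact mul_le_mul_of_nonneg_left hprod (by positivity)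
  -- invert the product
  have hne : ∀ r ∈ Ioc k n, ((r : ℝ) - β) ≠ 0 ∧ (r : ℝ) ≠ 0 := by
    intro r hr
    have hkr : k < r := (Finset.mem_Ioc.1 hr).1
    have : (k : ℝ) + 1 ≤ r := by exact_mod_cast hkr
    have hk0 : (0 : ℝ) ≤ k := by positivity
    exact ⟨by linarith, by linarith⟩
  have hinv : (∏ r ∈ Ioc k n, (((r : ℝ) - β) / r)) * (∏ r ∈ Ioc k n, ((r : ℝ) / ((r : ℝ) - β)))
      = 1 := by
    rw [← Finset.prod_mul_distrib]
    refine Finset.prod_eq_one fun r hr => ?_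
    obtain ⟨h1, h2⟩ := hne r hr
    field_simp
  have hpos : 0 < ∏ r ∈ Ioc k n, ((r : ℝ) / ((r : ℝ) - β)) := by
    refine Finset.prod_pos fun r hr => ?_
    have hkr : k < r := (Finset.mem_Ioc.1 hr).1
    have : (k : ℝ) + 1 ≤ r := by exact_mod_cast hkr
    exact div_pos (by linarith) (by linarith)
  calc P β k n = (2 : ℝ) ^ (k - 1) * ∏ r ∈ Ioc k n, ((r : ℝ) / ((r : ℝ) - β)) := rfl
    _ < ((n : ℝ) ^ β * ∏ r ∈ Ioc k n, (((r : ℝ) - β) / r)) *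
          ∏ r ∈ Ioc k n, ((r : ℝ) / ((r : ℝ) - β)) := mul_lt_mul_of_pos_right key hpos
    _ = (n : ℝ) ^ β := by rw [mul_assoc, hinv, mul_one]


end Karger1999

/-- **Karger's cut-counting theorem, proved** (Karger 1999, Thm. 2.6; Karger–Stein 1996, Thm. 8.4):
a multigraph on `n` vertices all of whose cuts have value `≥ c > 0` has, for every real `α ≥ 1`,
fewer than `n^{2α}` anchored cuts of value `≤ αc`. Discharges the named fact
`Karger1999_cutCounting` (proof: appendix of Karger 1999, Fact 7.1 – Thm. 7.5, see the module
docstring). [cite: Karger1999, Thm. 2.6] -/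
theorem Karger1999_cutCounting_holds : Karger1999_cutCounting := by
  intro n m v c α hc hα hcut
  classical
  -- `β = 2α`, `k = ⌈β⌉`
  set β : ℝ := 2 * α with hβ
  set k : ℕ := ⌈β⌉₊ with hk
  have hβ2 : (2 : ℝ) ≤ β := by rw [hβ]; linarith
  have hβ0 : (0 : ℝ) ≤ β := by linarith
  have hβk : β ≤ k := Nat.le_ceil β
  have hkβ : (k : ℝ) - 1 < β := by
    have := Nat.ceil_lt_add_one hβ0
    rw [hk]; linarith
  have hk2 : 2 ≤ k := by
    have h : (2 : ℝ) ≤ (k : ℝ) := hβ2.trans hβk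
    exact_mod_cast h
  have hcut' : ∀ S : Finset (Fin n), S.Nonempty → Sᶜ.Nonempty → c ≤ (Karger1999.cval m S : ℝ) :=
    hcut
  by_cases hkn : k ≤ n
  · -- `n ≥ k`: the recurrence bound `P` and the real inequality `P < n^β`
    have hsub : (Finset.univ.filter fun S : Finset (Fin n) =>
        v ∈ S ∧ Sᶜ.Nonempty ∧ (multigraphCutValue m S : ℝ) ≤ α * c)
          ⊆ Karger1999.fam m id v (α * c) := by
      intro S hS
      simp only [Finset.mem_filter, Finset.mem_univ, true_and] at hS
      have hsat : Karger1999.sat (id : Fin n → Fin n) S = S := by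
        ext x; simp [Karger1999.sat]
      simp only [Karger1999.fam, Finset.mem_filter, Finset.mem_powerset, Finset.image_id, id,
        Finset.subset_univ, true_and]
      refine ⟨hS.1, ?_, ?_⟩
      · rw [← Finset.compl_eq_univ_sdiff]; exact hS.2.1
      · rw [hsat]; exact hS.2.2
    have h1 : ((Finset.univ.filter fun S : Finset (Fin n) =>
        v ∈ S ∧ Sᶜ.Nonempty ∧ (multigraphCutValue m S : ℝ) ≤ α * c).card : ℝ)
          ≤ (Karger1999.fam m id v (α * c)).card := by
      exact_mod_cast Finset.card_le_card hsub
    have ht : 2 * (α * c) ≤ β * c := le_of_eq (by rw [hβ]; ring)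
    have h2 := Karger1999.card_fam_le_P m v hc hcut' hβ0 ht hβk (by omega) n id (by simp)
    have h3 := Karger1999.P_lt_rpow hk2 hkn hβk hkβ
    linarith
  · -- `n < k`: fewer than `2^{n-1} ≤ n^{n-1} ≤ n^β` anchored cuts altogether
    push Not at hkn
    have hn1 : 1 ≤ n := Fin.pos v
    have hF := Karger1999.card_anchored_succ_le v
      (fun S : Finset (Fin n) => (multigraphCutValue m S : ℝ) ≤ α * c)
    rw [Fintype.card_fin] at hF
    have h1 : ((Finset.univ.filter fun S : Finset (Fin n) =>
        v ∈ S ∧ Sᶜ.Nonempty ∧ (multigraphCutValue m S : ℝ) ≤ α * c).card : ℝ)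
          < (2 : ℝ) ^ (n - 1) := by
      exact_mod_cast Nat.lt_of_succ_le hF
    have h2 : (2 : ℝ) ^ (n - 1) ≤ (n : ℝ) ^ (n - 1) := by
      rcases Nat.lt_or_ge n 2 with h | h
      · interval_cases n; simp
      · exact pow_le_pow_left₀ (by norm_num) (by exact_mod_cast h) _
    have h3 : (n : ℝ) ^ (n - 1) ≤ (n : ℝ) ^ β := by
      rw [← Real.rpow_natCast]
      refine Real.rpow_le_rpow_of_exponent_le (by exact_mod_cast hn1) ?_
      have hnk' : (n : ℝ) + 1 ≤ k := by exact_mod_cast hkn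
      rw [Nat.cast_sub hn1]
      push_cast
      linarith
    linarith

end Literature.Probability.Percolation

end
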